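import Literature.Topology.FourManifolds.TrisectionFunctorGK
import Literature.AlgebraicTopology.FundamentalGroup.VanKampenPushout
import HarnessLib

/-!
# Abrams–Gay–Kirby's map `𝒢` lands in group trisections: the algebraic half of fact (a′)

Topic `Literature/Topology/FourManifolds`; sibling of `TrisectionFunctorGK.lean` (fact seat
`provefact-Literature.Topology.FourManifolds.isGroupTrisection_groupGKTrisectionOf`, named fact (a′)
`Literature.Topology.FourManifolds.isGroupTrisection_groupGKTrisectionOf`, Abrams–Gay–Kirby 2018, the map `𝒢`
of p. 1540 and Thm. 5).

## Status of (a′) and what this file does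

Fact (a′) says: for a balanced `(g, k)`-trisection `S` (sectors with corners along the central
surface, `IsBalancedGKTrisection`) of a closed connected oriented smooth `4`-manifold `X`, a base
point `x₀` on the central surface `F = ⋂ l, S l` and a marking `μ : S_g ≃* π₁(F, x₀)`, the kernel
triple `groupGKTrisectionOf h x₀ μ = (μ⁻¹ ker (π₁ F → π₁ Hᵢ))ᵢ` is a `(g, k)` group trisection of
`π₁(X, x₀)` (`IsGroupTrisection`, kernel form of AGK's Def. 1).  In the source this is the
assertion that the map `𝒢` is well defined — Abrams–Gay–Kirby, p. 1540: "There is an obvious map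
from the set of parametrized based trisected `4`-manifolds to the set of trisected groups, which we
will call `𝒢`; the groups are the fundamental groups of the `Xᵢ`'s and their intersections, after
identification with standard models via the parametrizations, and the maps are those induced by
inclusions composed with parametrizations" — and no proof is printed.  The standard argument has
four topological inputs, for `{i, j, l} = {0, 1, 2}`, `Hᵢ = S (i+1) ∩ S (i+2)` the handlebody
opposite to the sector `S i` and `φᵢ : π₁(F, x₀) → π₁(Hᵢ, x₀)` induced by the inclusion:

* **(T1)** `φᵢ` is surjective and `π₁(Hᵢ, x₀) ≅ F_g` (`Hᵢ` is a genus-`g` `3`-dimensional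
  `1`-handlebody with boundary `F`: clause (iii) of `IsGKTrisection` and the classification of
  `1`-handlebodies);
* **(T2)** the inclusion of `F` in the Heegaard splitting `Hᵢ ∪_F Hⱼ = ∂X_l` induces a surjection
  on `π₁` with kernel the normal closure of `ker φᵢ ∪ ker φⱼ` (Seifert–van Kampen for the cover of
  `∂X_l` by collar-thickenings of `Hᵢ`, `Hⱼ`: the pushout of two epimorphisms out of `π₁ F` is the
  quotient of `π₁ F` by the join of the kernels);
* **(T3)** `π₁(∂X_l) ≅ F_k`, and `π₁(∂X_l) → π₁(X_l)` is an isomorphism (`X_l ≅ ♮ᵏ(S¹ × B³)` is a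
  `4`-dimensional `1`-handlebody, `∂X_l ≅ #ᵏ(S¹ × S²)`; `∂X_l = Hᵢ ∪ Hⱼ` by invariance of domain);
* **(T4)** the inclusion `F ⊆ X` induces a surjection `π₁(F, x₀) → π₁(X, x₀)` with kernel the
  normal closure of `ker φ₀ ∪ ker φ₁ ∪ ker φ₂` (van Kampen for `X = X_l ∪ (Xᵢ ∪ Xⱼ)`, twice, using
  (T3)).

None of (T1)–(T4) is in the tree (no fundamental group of any handlebody is computed there, and the
Seifert–van Kampen theorem of `Literature/AlgebraicTopology/FundamentalGroup/VanKampenPushout.lean`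
is for covers by two *open* sets), and each is theory-sized over the Morse-theoretic handle
vocabulary of `Handles.lean`; (a′) itself therefore stays a named fact.  What this file PROVES is
the remaining, purely algebraic step:

* `IsGroupTrisection.of_comap_mulEquiv` — the kernel form is transported along the marking: if
  `N₀, N₁, N₂ ⊴ Γ`, `μ : S_g ≃* Γ`, each `Γ ⧸ Nᵢ` is free of rank `g`, each `Γ ⧸ ⟪Nᵢ ∪ Nⱼ⟫`
  (`i ≠ j`) is free of rank `k` and `Γ ⧸ ⟪N₀ ∪ N₁ ∪ N₂⟫ ≅ G`, then `(μ⁻¹ Nᵢ)ᵢ` is a `(g, k)`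
  group trisection of `G`;
* `IsGroupTrisection.of_ker_comap_mulEquiv` — the same with `Nᵢ = ker φᵢ` for epimorphisms
  `φᵢ : Γ ↠ Pᵢ` onto free groups of rank `g` (the printed form of Def. 1, cf.
  `GroupTrisection.ofHoms`);
* `IsFreeOfRank.quotient_of_ker_eq`, `nonempty_quotient_mulEquiv_of_ker_eq`,
  `nonempty_quotient_normalClosure_mulEquiv_of_eq_preimage` — first-isomorphism
  bookkeeping turning "a surjection with prescribed kernel onto a free group / onto `G`" (the form
  in which (T2)–(T4) are delivered by van Kampen) into the quotient hypotheses above;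
* `isGroupTrisection_groupGKTrisectionOf_of_fundamentalGroup` — **(a′) for one marked trisected
  manifold, from (T1)–(T4) stated in `π₁` terms for that manifold**: the conclusion
  `IsGroupTrisection g k (π₁(X, x₀)) (groupGKTrisectionOf h x₀ μ)` of (a′) follows from the
  surjectivity of the `φᵢ` with free targets of rank `g`, the freeness of rank `k` of
  `π₁ F ⧸ ⟪ker φᵢ ∪ ker φⱼ⟫`, and the surjectivity of `π₁(F, x₀) → π₁(X, x₀)` with kernel
  `⟪⋃ᵢ ker φᵢ⟫.  Markings play no role beyond transport (`groupGKTrisectionOf_iso_of_markings`).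

Nothing here weakens or restates (a′); the unconditional `isGroupTrisection_groupGKTrisectionOf_holds`
is NOT claimed.

## References

* A. Abrams, D. Gay, R. Kirby, *Group trisections and smooth 4-manifolds*, Geom. Topol. 22 (2018)
  1537–1545 (arXiv:1605.06731): Def. 1 (p. 1538; arXiv p. 2), the map `𝒢` (p. 1540; arXiv p. 2,
  last paragraph), Thm. 5 (p. 1541; arXiv p. 3). [AbramsGayKirby2018]
* A. Hatcher, *Algebraic Topology*, CUP (2002), §1.2, Thm. 1.20 (van Kampen) and Prop. 1.26 — the
  tools behind (T2), (T4). [HatcherAT2002]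
-/

noncomputable section

open Set Subgroup Literature.AlgebraicTopology.FundamentalGroup
open scoped Manifold ContDiff

namespace Literature.Topology.FourManifolds

universe u

/-! ### First-isomorphism bookkeeping -/

section Algebra

variable {A Γ : Type*} [Group A] [Group Γ]

/-- A quotient `Γ ⧸ N` by the kernel `N = ker ψ` of a surjection onto a group free of rank `n` is
free of rank `n` (first isomorphism theorem). [folklore] -/
theorem IsFreeOfRank.quotient_of_ker_eq {Q : Type*} [Group Q] {n : ℕ} (ψ : Γ →* Q)
    (hψ : Function.Surjective ψ) {N : Subgroup Γ} [N.Normal] (hker : ψ.ker = N)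
    (hQ : IsFreeOfRank Q n) : IsFreeOfRank (Γ ⧸ N) n :=
  (hQ.of_mulEquiv (QuotientGroup.quotientKerEquivOfSurjective ψ hψ).symm).of_mulEquiv
    (QuotientGroup.quotientMulEquivOfEq hker)

/-- A quotient `Γ ⧸ N` by the kernel `N = ker ψ` of a surjection onto `G` is isomorphic to `G`
(first isomorphism theorem). [folklore] -/
theorem nonempty_quotient_mulEquiv_of_ker_eq {G : Type*} [Group G] (ψ : Γ →* G)
    (hψ : Function.Surjective ψ) {N : Subgroup Γ} [N.Normal] (hker : ψ.ker = N) :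
    Nonempty (Γ ⧸ N ≃* G) :=
  ⟨(QuotientGroup.quotientMulEquivOfEq hker.symm).trans
    (QuotientGroup.quotientKerEquivOfSurjective ψ hψ)⟩

/-- Pulling back along an isomorphism `μ : A ≃* Γ` commutes with quotients by normal closures:
`A ⧸ ⟪μ⁻¹ s⟫ ≃* Γ ⧸ ⟪s⟫` (stated for any `t = μ⁻¹ s`, to be fed the underlying sets of pulled-back
subgroups). [folklore] -/
theorem nonempty_quotient_normalClosure_mulEquiv_of_eq_preimage (μ : A ≃* Γ) (s : Set Γ)
    {t : Set A} (ht : t = μ ⁻¹' s) :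
    Nonempty (A ⧸ normalClosure t ≃* Γ ⧸ normalClosure s) := by
  subst ht
  refine ⟨(QuotientGroup.quotientMulEquivOfEq (comap_normalClosure s μ)).trans
    (QuotientGroup.congr _ _ μ ?_)⟩
  exact map_comap_eq_self_of_surjective (fun x => ⟨μ.symm x, by simp⟩) _

/-! ### The kernel form transported along the marking -/

/-- **Transport of the kernel form of a group trisection along the marking.**  Let
`μ : S_g ≃* Γ` be an isomorphism and `N₀, N₁, N₂` normal subgroups of `Γ` such that each
`Γ ⧸ Nᵢ` is free of rank `g`, each `Γ ⧸ ⟪Nᵢ ∪ Nⱼ⟫` (`i ≠ j`) is free of rank `k`, and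
`Γ ⧸ ⟪N₀ ∪ N₁ ∪ N₂⟫ ≅ G`.  Then the pulled-back triple `(μ⁻¹ Nᵢ)ᵢ` is a `(g, k)` group
trisection of `G` in the sense of `IsGroupTrisection` (Abrams–Gay–Kirby's Def. 1 in kernel form:
the vertex groups of the cube are the quotients of `S_g` by the joins of the kernels).
[cite: AbramsGayKirby2018, Def. 1 (p. 1538)] -/
theorem IsGroupTrisection.of_comap_mulEquiv {g k : ℕ} {G : Type*} [Group G]
    (μ : SurfaceGroup g ≃* Γ) (N : Fin 3 → Subgroup Γ) (hN : ∀ i, (N i).Normal)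
    (h₁ : ∀ i, IsFreeOfRank (Γ ⧸ normalClosure (N i : Set Γ)) g)
    (h₂ : ∀ i j, i ≠ j → IsFreeOfRank (Γ ⧸ normalClosure ((N i : Set Γ) ∪ N j)) k)
    (h₃ : Nonempty (Γ ⧸ normalClosure (⋃ i, (N i : Set Γ)) ≃* G)) :
    IsGroupTrisection g k G (fun i => (N i).comap μ.toMonoidHom) := by
  refine ⟨fun i => ?_, fun i => ?_, fun i j hij => ?_, ?_⟩
  · haveI := hN i
    exact Subgroup.normal_comap _
  · obtain ⟨e⟩ := nonempty_quotient_normalClosure_mulEquiv_of_eq_preimage μ (N i : Set Γ)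
      (t := ((N i).comap μ.toMonoidHom : Set (SurfaceGroup g))) (by ext x; simp)
    exact (h₁ i).of_mulEquiv e.symm
  · obtain ⟨e⟩ := nonempty_quotient_normalClosure_mulEquiv_of_eq_preimage μ ((N i : Set Γ) ∪ N j)
      (t := ((N i).comap μ.toMonoidHom : Set (SurfaceGroup g)) ∪ (N j).comap μ.toMonoidHom)
      (by ext x; simp)
    exact (h₂ i j hij).of_mulEquiv e.symm
  · obtain ⟨e⟩ := nonempty_quotient_normalClosure_mulEquiv_of_eq_preimage μ (⋃ i, (N i : Set Γ))
      (t := ⋃ i, ((N i).comap μ.toMonoidHom : Set (SurfaceGroup g))) (by ext x; simp)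
    exact h₃.map fun f => e.trans f

/-- **The printed form of Def. 1, transported along the marking.**  Let `μ : S_g ≃* Γ` and let
`φᵢ : Γ ↠ Pᵢ` (`i = 0, 1, 2`) be surjections onto groups free of rank `g` such that
`Γ ⧸ ⟪ker φᵢ ∪ ker φⱼ⟫` is free of rank `k` for `i ≠ j` and `Γ ⧸ ⟪⋃ᵢ ker φᵢ⟫ ≅ G`.  Then
`(μ⁻¹ ker φᵢ)ᵢ` is a `(g, k)` group trisection of `G` (cf. `GroupTrisection.ofHoms`, the case
`Γ = S_g`, `μ = id`). [cite: AbramsGayKirby2018, Def. 1 (p. 1538)] -/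
theorem IsGroupTrisection.of_ker_comap_mulEquiv {g k : ℕ} {G : Type*} [Group G]
    {P : Fin 3 → Type*} [∀ i, Group (P i)] (μ : SurfaceGroup g ≃* Γ) (φ : ∀ i, Γ →* P i)
    (surj : ∀ i, Function.Surjective (φ i)) (free : ∀ i, IsFreeOfRank (P i) g)
    (pair : ∀ i j, i ≠ j → IsFreeOfRank (Γ ⧸ normalClosure (((φ i).ker : Set Γ) ∪ (φ j).ker)) k)
    (triple : Nonempty (Γ ⧸ normalClosure (⋃ i, ((φ i).ker : Set Γ)) ≃* G)) :
    IsGroupTrisection g k G (fun i => (φ i).ker.comap μ.toMonoidHom) :=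
  IsGroupTrisection.of_comap_mulEquiv μ (fun i => (φ i).ker) (fun _ => inferInstance)
    (fun i => IsFreeOfRank.quotient_of_ker_eq (φ i) (surj i) (normalClosure_eq_self _).symm (free i))
    pair triple

end Algebra

/-! ### (a′) for one marked trisected manifold, from its topological inputs in `π₁` terms -/

section Functor

variable {X : Type u} [TopologicalSpace X] [ChartedSpace (EuclideanSpace ℝ (Fin 4)) X]
  {g : ℕ} {k : Fin 3 → ℕ} {S : Fin 3 → Set X}

/-- **Fact (a′) for one marked trisected manifold, reduced to its topological inputs.**  Let `S`
be a Gay–Kirby trisection of `X` (any `(g; k₀, k₁, k₂)`, sectors with corners along the central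
surface), `x₀ ∈ F = ⋂ l, S l`, `μ : S_g ≃* π₁(F, x₀)` a marking, and write
`φᵢ : π₁(F, x₀) → π₁(Hᵢ, x₀)` for the map induced by the inclusion of `F` in the handlebody
`Hᵢ = S (i+1) ∩ S (i+2)` (`centralInclusion`).  Suppose
(T1) each `φᵢ` is surjective onto a group free of rank `g`;
(T2)+(T3) for `i ≠ j`, `π₁(F, x₀) ⧸ ⟪ker φᵢ ∪ ker φⱼ⟫` is free of rank `k` (i.e. `π₁` of the
Heegaard splitting `Hᵢ ∪_F Hⱼ = ∂X_l ≅ #ᵏ(S¹ × S²)`, by van Kampen);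
(T4) the inclusion `F ⊆ X` (`Literature.AlgebraicTopology.FundamentalGroup.VanKampen.incl`, the
vocabulary of the tree's Seifert–van Kampen theorem) induces a surjection `π₁(F, x₀) → π₁(X, x₀)`
whose kernel is `⟪ker φ₀ ∪ ker φ₁ ∪ ker φ₂⟫` (van Kampen for the three sectors).
Then the kernel triple `groupGKTrisectionOf h x₀ μ` is a `(g, k)` group trisection of `π₁(X, x₀)`
— the conclusion of (a′) `isGroupTrisection_groupGKTrisectionOf` for this `(X, S, x₀, μ)`.  This
is the algebraic content of Abrams–Gay–Kirby's remark that the map `𝒢` ("the groups are the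
fundamental groups of the `Xᵢ`'s and their intersections … the maps are those induced by
inclusions") takes values in group trisections; the topological inputs (T1)–(T4) are not proved
in the tree. [cite: AbramsGayKirby2018, p. 1540 (the map 𝒢) and Def. 1 (p. 1538)] -/
theorem isGroupTrisection_groupGKTrisectionOf_of_fundamentalGroup (h : IsGKTrisection X g k S)
    (x₀ : centralSurface S) (μ : SurfaceGroup g ≃* FundamentalGroup (centralSurface S) x₀) {n : ℕ}
    (surj : ∀ i, Function.Surjective (FundamentalGroup.map (centralInclusion S i) x₀))
    (free : ∀ i, IsFreeOfRank (FundamentalGroup (handlebodyOpp S i) (centralInclusion S i x₀)) g)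
    (pair : ∀ i j, i ≠ j → IsFreeOfRank (FundamentalGroup (centralSurface S) x₀ ⧸ normalClosure
      (((FundamentalGroup.map (centralInclusion S i) x₀).ker : Set _) ∪
        (FundamentalGroup.map (centralInclusion S j) x₀).ker)) n)
    (whole : Function.Surjective (FundamentalGroup.map (VanKampen.incl (⋂ l, S l)) x₀) ∧
      (FundamentalGroup.map (VanKampen.incl (⋂ l, S l)) x₀).ker =
        normalClosure (⋃ i, ((FundamentalGroup.map (centralInclusion S i) x₀).ker : Set _))) :
    IsGroupTrisection g n (FundamentalGroup X (x₀ : X)) (groupGKTrisectionOf h x₀ μ) :=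
  IsGroupTrisection.of_ker_comap_mulEquiv μ (fun i => FundamentalGroup.map (centralInclusion S i) x₀)
    surj free pair (nonempty_quotient_mulEquiv_of_ker_eq _ whole.1 whole.2)

end Functor

end Literature.Topology.FourManifolds

end
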